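import Summits.KontsevichZagierPeriods.KontsevichZagierPeriods.Theses.TerasomaMultiplication
import Mathlib.Analysis.SpecialFunctions.Pow.Deriv

/-!
# `MultiplicationAccessible` (stmt-KontsevichZagierPeriods-12305), line `shifted-family-prime-sieve`:
closedness of the corner Stokes form at `p = 3` (registered stub `cornerClosedThree`)

The shifted Gauss triplication is proved by Stokes on the 4-dimensional region `W = {(θ₁, θ₂, y, v)}`
(corner blow-up coordinates of the cube, `t_k = 1 − yθ_k`, plus `v ∈ (0,1)`) for the 3-form
`Λ = a(vζ) d(vζ) ∧ Ξ` with components `c0, c1, c2, c3`; this file proves `dΛ = 0`, i.e.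
`∂_{θ₁} c0 − ∂_{θ₂} c1 + ∂_y c2 − ∂_v c3 = 0` on `W` (atoms `Z, S, H, K, M0, M1, M2, P`).
Proof: the partial derivatives exist by hypothesis, so by uniqueness it suffices to differentiate the
explicit one-variable functions (log-derivative form of every `rpow` atom; `H = (1 + Z + Z²)/S` is
first replaced near the point by `y/(1 − Z)`, from `y·S = 1 − Z³`) and to check an algebraic identity:
after dividing by `P` it splits into three relation-free rational identities `lemA`, `lemB`, `lemC`
(`field_simp; ring`), a formal assembly `key` (`linear_combination`) and the single relation
`Z·(M0/t₀ + M1/t₁ + M2/t₂) = M0 + M1 + M2` (`sigma_rel`). Reference: Kontsevich–Zagier 2001 §1.2.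
-/

noncomputable section

open MeasureTheory Set Real
open scoped BigOperators Topology

namespace Summit.KontsevichZagierPeriods.TerasomaMultiplication.MultiplicationAccessible

namespace CornerClosed

/-- Power rule in logarithmic form: `(f^p)' = f^p · (p f'/f)` at a point where `f > 0`
(calculus step for the closedness of the corner Stokes form). [cite: KontsevichZagier2001, §1.2] -/
theorem hasDerivAt_rpow_log {f : ℝ → ℝ} {f' a : ℝ} (hf : HasDerivAt f f' a) (h : 0 < f a)
    (p : ℝ) : HasDerivAt (fun t => f t ^ p) (f a ^ p * (p * f' / f a)) a := by
  refine (hf.rpow_const (Or.inl h.ne')).congr_deriv ?_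
  rw [Real.rpow_sub_one h.ne']
  field_simp

/-- Derivative of a monomial `t₀^e₀ t₁^e₁ t₂^e₂` of three positive differentiable functions, in
logarithmic form (the atoms `M0, M1, M2`). [cite: KontsevichZagier2001, §1.2] -/
theorem hasDerivAt_M3 {t₀ t₁ t₂ : ℝ → ℝ} {d₀ d₁ d₂ a : ℝ} (h₀ : HasDerivAt t₀ d₀ a)
    (h₁ : HasDerivAt t₁ d₁ a) (h₂ : HasDerivAt t₂ d₂ a) (p₀ : 0 < t₀ a) (p₁ : 0 < t₁ a)
    (p₂ : 0 < t₂ a) (e₀ e₁ e₂ : ℝ) :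
    HasDerivAt (fun t => t₀ t ^ e₀ * t₁ t ^ e₁ * t₂ t ^ e₂) (t₀ a ^ e₀ * t₁ a ^ e₁ * t₂ a ^ e₂ *
      (e₀ * d₀ / t₀ a + e₁ * d₁ / t₁ a + e₂ * d₂ / t₂ a)) a := by
  refine (((hasDerivAt_rpow_log h₀ p₀ e₀).fun_mul (hasDerivAt_rpow_log h₁ p₁ e₁)).fun_mul
    (hasDerivAt_rpow_log h₂ p₂ e₂)).congr_deriv ?_
  ring

/-- Derivative of `(t₀t₁t₂)^p` in logarithmic form (the geometric mean `ζ = Z`).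
[cite: KontsevichZagier2001, §1.2] -/
theorem hasDerivAt_Z3 {t₀ t₁ t₂ : ℝ → ℝ} {d₀ d₁ d₂ a : ℝ} (h₀ : HasDerivAt t₀ d₀ a)
    (h₁ : HasDerivAt t₁ d₁ a) (h₂ : HasDerivAt t₂ d₂ a) (p₀ : 0 < t₀ a) (p₁ : 0 < t₁ a)
    (p₂ : 0 < t₂ a) (p : ℝ) :
    HasDerivAt (fun t => (t₀ t * t₁ t * t₂ t) ^ p) ((t₀ a * t₁ a * t₂ a) ^ p *
      (p * (d₀ / t₀ a + d₁ / t₁ a + d₂ / t₂ a))) a := by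
  refine (hasDerivAt_rpow_log ((h₀.fun_mul h₁).fun_mul h₂) (by positivity) p).congr_deriv ?_
  have := p₀.ne'; have := p₁.ne'; have := p₂.ne'
  field_simp

/-- Derivative of the factor `H = y/(1 − ζ)` along a `θ`-direction (`y` fixed), in logarithmic form.
[cite: KontsevichZagier2001, §1.2] -/
theorem hasDerivAt_Hθ {Zf : ℝ → ℝ} {G a : ℝ} (y : ℝ) (hZ : HasDerivAt Zf (Zf a * G) a)
    (h1 : Zf a < 1) :
    HasDerivAt (fun t => y / (1 - Zf t)) (y / (1 - Zf a) * (Zf a * G / (1 - Zf a))) a := by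
  have hne : 1 - Zf a ≠ 0 := by linarith
  refine ((hasDerivAt_const a y).fun_div (hZ.const_sub 1) hne).congr_deriv ?_
  field_simp
  ring

/-- Derivative of the factor `H = y/(1 − ζ)` along the `y`-direction, in logarithmic form.
[cite: KontsevichZagier2001, §1.2] -/
theorem hasDerivAt_Hy {Zf : ℝ → ℝ} {G a : ℝ} (hZ : HasDerivAt Zf (Zf a * G) a)
    (h1 : Zf a < 1) (ha : a ≠ 0) :
    HasDerivAt (fun t => t / (1 - Zf t)) (a / (1 - Zf a) * (1 / a + Zf a * G / (1 - Zf a))) a := by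
  have hne : 1 - Zf a ≠ 0 := by linarith
  refine ((hasDerivAt_id' a).fun_div (hZ.const_sub 1) hne).congr_deriv ?_
  field_simp
  ring

/-- Derivative of the common factor `P = V (1 − vζ)^(3s−1) H^(3s) K` in logarithmic form, given the
log-derivatives of `ζ`, `H`, `K`. [cite: KontsevichZagier2001, §1.2] -/
theorem hasDerivAt_P {Zf Hf Kf : ℝ → ℝ} {G hl kl a : ℝ} (V v s : ℝ)
    (hZ : HasDerivAt Zf (Zf a * G) a) (hH : HasDerivAt Hf (Hf a * hl) a)
    (hK : HasDerivAt Kf (Kf a * kl) a) (hvz : 0 < 1 - v * Zf a) (hHp : 0 < Hf a)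
    (hKp : 0 < Kf a) :
    HasDerivAt (fun t => V * (1 - v * Zf t) ^ (3 * s - 1) * Hf t ^ (3 * s) * Kf t)
      (V * (1 - v * Zf a) ^ (3 * s - 1) * Hf a ^ (3 * s) * Kf a *
        (-(3 * s - 1) * v * Zf a * G / (1 - v * Zf a) + 3 * s * hl + kl)) a := by
  have hB := hasDerivAt_rpow_log ((hZ.const_mul v).const_sub 1) hvz (3 * s - 1)
  have hG := hasDerivAt_rpow_log hH hHp (3 * s)
  refine (((hB.const_mul V).fun_mul hG).fun_mul hK).congr_deriv ?_
  have := hvz.ne'; have := hHp.ne'; have := hKp.ne'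
  field_simp

/-- The spelling relation `H = (1 + ζ + ζ²)/S = y/(1 − ζ)` on the chart (from `y·S = 1 − ζ³`), written
for the literal polynomial `S` and `ζ = (t₀t₁t₂)^(1/3)`, `t₀ = 1 − Y(1−A−B)`, `t₁ = 1 − YA`,
`t₂ = 1 − YB`, whenever `0 < t₀t₁t₂ < 1`. [cite: KontsevichZagier2001, §1.2] -/
theorem H_simpl (A B Y : ℝ) (h0 : 0 < (1 - Y * (1 - A - B)) * (1 - Y * A) * (1 - Y * B))
    (h1 : (1 - Y * (1 - A - B)) * (1 - Y * A) * (1 - Y * B) < 1) :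
    (1 + ((1 - Y * (1 - A - B)) * (1 - Y * A) * (1 - Y * B)) ^ ((1:ℝ)/3) +
        (((1 - Y * (1 - A - B)) * (1 - Y * A) * (1 - Y * B)) ^ ((1:ℝ)/3)) ^ 2) /
      (1 - Y * ((1 - A - B) * A + (1 - A - B) * B + A * B) + Y ^ 2 * ((1 - A - B) * A * B)) =
    Y / (1 - ((1 - Y * (1 - A - B)) * (1 - Y * A) * (1 - Y * B)) ^ ((1:ℝ)/3)) := by
  set T := (1 - Y * (1 - A - B)) * (1 - Y * A) * (1 - Y * B) with hT
  set Z := T ^ ((1:ℝ)/3) with hZ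
  have hZ3 : Z ^ 3 = T := by
    rw [hZ, ← Real.rpow_natCast, ← Real.rpow_mul h0.le]; norm_num
  have hZ1 : Z < 1 := Real.rpow_lt_one h0.le h1 (by norm_num)
  have hS : Y * (1 - Y * ((1 - A - B) * A + (1 - A - B) * B + A * B) +
      Y ^ 2 * ((1 - A - B) * A * B)) = 1 - T := by rw [hT]; ring
  have hSne : 1 - Y * ((1 - A - B) * A + (1 - A - B) * B + A * B) +
      Y ^ 2 * ((1 - A - B) * A * B) ≠ 0 := by
    intro h; rw [h, mul_zero] at hS; linarith
  rw [div_eq_div_iff hSne (by linarith)]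
  linear_combination (-1:ℝ) * hZ3 - hS

/-- Exponent bookkeeping `ζ · t₀^a₀ t₁^a₁ t₂^a₂ = t₀^(a₀+1/3) t₁^(a₁+1/3) t₂^(a₂+1/3)` for positive
bases. [cite: KontsevichZagier2001, §1.2] -/
theorem rel {t₀ t₁ t₂ : ℝ} (h₀ : 0 < t₀) (h₁ : 0 < t₁) (h₂ : 0 < t₂) (a₀ a₁ a₂ c₀ c₁ c₂ : ℝ)
    (e₀ : a₀ + 1/3 = c₀) (e₁ : a₁ + 1/3 = c₁) (e₂ : a₂ + 1/3 = c₂) :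
    (t₀ * t₁ * t₂) ^ ((1:ℝ)/3) * (t₀ ^ a₀ * t₁ ^ a₁ * t₂ ^ a₂) = t₀ ^ c₀ * t₁ ^ c₁ * t₂ ^ c₂ := by
  rw [Real.mul_rpow (by positivity) h₂.le, Real.mul_rpow h₀.le h₁.le, ← e₀, ← e₁, ← e₂,
    Real.rpow_add h₀, Real.rpow_add h₁, Real.rpow_add h₂]
  ring

/-- The cyclic monomial identity `ζ·(M0/t₀ + M1/t₁ + M2/t₂) = M0 + M1 + M2`
(`ζM0 = t₀M2`, `ζM1 = t₁M0`, `ζM2 = t₂M1`): the only relation between the `rpow` atoms used in the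
closedness computation. [cite: KontsevichZagier2001, §1.2] -/
theorem sigma_rel {t₀ t₁ t₂ : ℝ} (h₀ : 0 < t₀) (h₁ : 0 < t₁) (h₂ : 0 < t₂) (x : ℝ) :
    (t₀ * t₁ * t₂) ^ ((1:ℝ)/3) * (t₀ ^ x * t₁ ^ (x - 2/3) * t₂ ^ (x - 1/3) / t₀ +
      t₀ ^ (x - 1/3) * t₁ ^ x * t₂ ^ (x - 2/3) / t₁ + t₀ ^ (x - 2/3) * t₁ ^ (x - 1/3) * t₂ ^ x / t₂) =
    t₀ ^ x * t₁ ^ (x - 2/3) * t₂ ^ (x - 1/3) + t₀ ^ (x - 1/3) * t₁ ^ x * t₂ ^ (x - 2/3) +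
      t₀ ^ (x - 2/3) * t₁ ^ (x - 1/3) * t₂ ^ x := by
  have r0 := rel h₀ h₁ h₂ x (x - 2/3) (x - 1/3) (x - 2/3 + 1) (x - 1/3) x (by ring) (by ring) (by ring)
  have r1 := rel h₀ h₁ h₂ (x - 1/3) x (x - 2/3) x (x - 2/3 + 1) (x - 1/3) (by ring) (by ring) (by ring)
  have r2 := rel h₀ h₁ h₂ (x - 2/3) (x - 1/3) x (x - 1/3) x (x - 2/3 + 1) (by ring) (by ring) (by ring)
  rw [Real.rpow_add_one h₀.ne'] at r0
  rw [Real.rpow_add_one h₁.ne'] at r1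
  rw [Real.rpow_add_one h₂.ne'] at r2
  rw [mul_add, mul_add, ← mul_div_assoc, ← mul_div_assoc, ← mul_div_assoc, r0, r1, r2]
  field_simp
  ring

/-- Formal assembly of the closedness identity: with the brackets `B_i`, their derivatives `dB_i`, the
log-derivatives `G_i` of `ζ` and `k_i` of `θ₀θ₁θ₂` treated as free symbols, the combination
`E0 − E1 + E2 − E3` of the four (normalised) partial derivatives reduces, modulo the three free
identities `lemA`, `lemB`, `lemC`, to `s·(Σ' − ζ(Σ − Σ')/(1 − ζ))/y`, which vanishes by `sigma_rel`.
[cite: KontsevichZagier2001, §1.2] -/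
theorem key {th1 th2 y v x s Z B0 B1 B2 dB0 dB1 dB2 G0 G1 G2 k0 k1 Sg Sg' : ℝ}
    (hA : 3 * (th1 * G0 * B0 / y) - 3 * (th2 * G1 * B1 / y) - 3 * (G2 * B2) = (Sg - Sg') / y)
    (hB : -(k0 / ((1 - th1 - th2) * th1 * th2)) * th1 * B0 +
      (k1 / ((1 - th1 - th2) * th1 * th2)) * th2 * B1 = -(3 * B2 - Sg'))
    (hC : -B0 / y - th1 * dB0 / y + B1 / y + th2 * dB1 / y + dB2 + x * (Sg - Sg') / y =
      -(3 * B2 - Sg') / y) :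
    -((-(3 * s - 1) * v * Z * G0 / (1 - v * Z) + 3 * s * (Z * G0 / (1 - Z)) +
          (s - 1) * k0 / ((1 - th1 - th2) * th1 * th2)) * th1 * B0 + B0 + th1 * dB0) / y -
      -((-(3 * s - 1) * v * Z * G1 / (1 - v * Z) + 3 * s * (Z * G1 / (1 - Z)) +
          (s - 1) * k1 / ((1 - th1 - th2) * th1 * th2)) * th2 * B1 + B1 + th2 * dB1) / y +
      ((-(3 * s - 1) * v * Z * G2 / (1 - v * Z) + 3 * s * (1 / y + Z * G2 / (1 - Z)) + 0) * B2 +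
        dB2) -
      -(1 / 3 * ((Sg - Sg') / y) * (3 * x - (3 * s - 1) * v * Z / (1 - v * Z))) =
    s * (Sg' - Z * (Sg - Sg') / (1 - Z)) / y := by
  linear_combination ((3 * s - 1) * v * Z / (1 - v * Z) / 3 - s * Z / (1 - Z)) * hA +
    ((s - 1) / y) * hB + hC

/-- Free identity A (the `dg ∧ dg = 0` part: coefficient of `(3s−1)vζ/(1−vζ)`).
[cite: KontsevichZagier2001, §1.2] -/
theorem lemA (th1 th2 y t0 t1 t2 M0 M1 M2 : ℝ) (e0 : t0 = 1 - y * (1 - th1 - th2))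
    (e1 : t1 = 1 - y * th1) (e2 : t2 = 1 - y * th2) (hy : y ≠ 0) (h0 : t0 ≠ 0) (h1 : t1 ≠ 0)
    (h2 : t2 ≠ 0) :
    3 * (th1 * (1 / 3 * (y / t0 + -y / t1 + 0 / t2)) *
        ((1 - th1 - th2) * M0 - (1 - th1) * M1 + th2 * M2) / y) -
      3 * (th2 * (1 / 3 * (y / t0 + 0 / t1 + -y / t2)) *
        (-((1 - th1 - th2) * M0) - th1 * M1 + (1 - th2) * M2) / y) -
      3 * (1 / 3 * (-(1 - th1 - th2) / t0 + -th1 / t1 + -th2 / t2) *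
        ((1 - th1 - th2) * M0 + th1 * M1 + th2 * M2)) =
    ((M0 / t0 + M1 / t1 + M2 / t2) - (M0 + M1 + M2)) / y := by
  field_simp
  subst e0 e1 e2
  ring

/-- Free identity B (the `K`-log-derivative part). [cite: KontsevichZagier2001, §1.2] -/
theorem lemB (th1 th2 M0 M1 M2 : ℝ) (h0 : 1 - th1 - th2 ≠ 0) (h1 : th1 ≠ 0) (h2 : th2 ≠ 0) :
    -(th2 * ((1 - th1 - th2) - th1) / ((1 - th1 - th2) * th1 * th2)) * th1 *
        ((1 - th1 - th2) * M0 - (1 - th1) * M1 + th2 * M2) +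
      (th1 * ((1 - th1 - th2) - th2) / ((1 - th1 - th2) * th1 * th2)) * th2 *
        (-((1 - th1 - th2) * M0) - th1 * M1 + (1 - th2) * M2) =
    -(3 * ((1 - th1 - th2) * M0 + th1 * M1 + th2 * M2) - (M0 + M1 + M2)) := by
  field_simp
  ring

/-- Free identity C (the `x`-terms and the bare terms of the bracket derivatives).
[cite: KontsevichZagier2001, §1.2] -/
theorem lemC (th1 th2 y x t0 t1 t2 M0 M1 M2 : ℝ) (e0 : t0 = 1 - y * (1 - th1 - th2))
    (e1 : t1 = 1 - y * th1) (e2 : t2 = 1 - y * th2) (hy : y ≠ 0) (h0 : t0 ≠ 0) (h1 : t1 ≠ 0)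
    (h2 : t2 ≠ 0) :
    -((1 - th1 - th2) * M0 - (1 - th1) * M1 + th2 * M2) / y -
      th1 * (-M0 + (1 - th1 - th2) * (M0 * (x * y / t0 + (x - 2/3) * -y / t1 + (x - 1/3) * 0 / t2))
        + M1 - (1 - th1) * (M1 * ((x - 1/3) * y / t0 + x * -y / t1 + (x - 2/3) * 0 / t2))
        + th2 * (M2 * ((x - 2/3) * y / t0 + (x - 1/3) * -y / t1 + x * 0 / t2))) / y +
      (-((1 - th1 - th2) * M0) - th1 * M1 + (1 - th2) * M2) / y +
      th2 * (M0 - (1 - th1 - th2) * (M0 * (x * y / t0 + (x - 2/3) * 0 / t1 + (x - 1/3) * -y / t2))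
        - th1 * (M1 * ((x - 1/3) * y / t0 + x * 0 / t1 + (x - 2/3) * -y / t2))
        - M2 + (1 - th2) * (M2 * ((x - 2/3) * y / t0 + (x - 1/3) * 0 / t1 + x * -y / t2))) / y +
      ((1 - th1 - th2) * (M0 * (x * -(1 - th1 - th2) / t0 + (x - 2/3) * -th1 / t1 +
          (x - 1/3) * -th2 / t2)) +
        th1 * (M1 * ((x - 1/3) * -(1 - th1 - th2) / t0 + x * -th1 / t1 + (x - 2/3) * -th2 / t2)) +
        th2 * (M2 * ((x - 2/3) * -(1 - th1 - th2) / t0 + (x - 1/3) * -th1 / t1 + x * -th2 / t2))) +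
      x * ((M0 / t0 + M1 / t1 + M2 / t2) - (M0 + M1 + M2)) / y =
    -(3 * ((1 - th1 - th2) * M0 + th1 * M1 + th2 * M2) - (M0 + M1 + M2)) / y := by
  field_simp
  subst e0 e1 e2
  ring

end CornerClosed

/-- **Closedness of the corner Stokes 3-form at `p = 3`** (registered stub `cornerClosedThree` of the
line `shifted-family-prime-sieve`). In the corner blow-up coordinates `w = (θ₁, θ₂, y, v)` of
`W`, with the atoms `Z` (geometric mean `ζ`), `S`, `H = (1+ζ+ζ²)/S`, `K = (θ₀θ₁θ₂)^(s−1)`, `M0, M1, M2`,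
`P = v^(3x−1)(1−vζ)^(3s−1)H^(3s)K` and the components `c0, c1, c2, c3` of `Λ = a(vζ)d(vζ) ∧ Ξ`, any
partial derivatives `d0 = ∂_{θ₁}c0`, `d1 = ∂_{θ₂}c1`, `d2 = ∂_y c2`, `d3 = ∂_v c3` at a point of `W`
satisfy `d0 − d1 + d2 − d3 = 0` (`dΛ = 0`). [cite: KontsevichZagier2001, §1.2] -/
theorem cornerClosedThree : ∀ (x s : ℚ), 2 ≤ x → 3 ≤ s → ∀ (Z S H K M0 M1 M2 P : (Fin 4 → ℝ) → ℝ),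
    (∀ w, Z w = ((1 - w 2 * (1 - w 0 - w 1)) * (1 - w 2 * w 0) * (1 - w 2 * w 1)) ^ ((1:ℝ)/3)) →
    (∀ w, S w = 1 - w 2 * ((1 - w 0 - w 1) * w 0 + (1 - w 0 - w 1) * w 1 + w 0 * w 1) +
      (w 2) ^ 2 * ((1 - w 0 - w 1) * w 0 * w 1)) →
    (∀ w, H w = (1 + Z w + Z w ^ 2) / S w) →
    (∀ w, K w = ((1 - w 0 - w 1) * w 0 * w 1) ^ ((s:ℝ) - 1)) →
    (∀ w, M0 w = (1 - w 2 * (1 - w 0 - w 1)) ^ (x:ℝ) * (1 - w 2 * w 0) ^ ((x:ℝ) - 2/3) * (1 - w 2 * w 1) ^ ((x:ℝ) - 1/3)) →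
    (∀ w, M1 w = (1 - w 2 * (1 - w 0 - w 1)) ^ ((x:ℝ) - 1/3) * (1 - w 2 * w 0) ^ (x:ℝ) * (1 - w 2 * w 1) ^ ((x:ℝ) - 2/3)) →
    (∀ w, M2 w = (1 - w 2 * (1 - w 0 - w 1)) ^ ((x:ℝ) - 2/3) * (1 - w 2 * w 0) ^ ((x:ℝ) - 1/3) * (1 - w 2 * w 1) ^ (x:ℝ)) →
    (∀ w, P w = (w 3) ^ (3 * (x:ℝ) - 1) * (1 - w 3 * Z w) ^ (3 * (s:ℝ) - 1) * H w ^ (3 * (s:ℝ)) * K w) →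
    ∀ (c0 c1 c2 c3 : (Fin 4 → ℝ) → ℝ), (∀ w, c0 w = -(P w * w 0 * ((1 - w 0 - w 1) * M0 w - (1 - w 0) * M1 w + w 1 * M2 w) / w 2)) →
    (∀ w, c1 w = -(P w * w 1 * (-((1 - w 0 - w 1) * M0 w) - w 0 * M1 w + (1 - w 1) * M2 w) / w 2)) →
    (∀ w, c2 w = P w * ((1 - w 0 - w 1) * M0 w + w 0 * M1 w + w 1 * M2 w)) →
    (∀ w, c3 w = -(1/3 * (w 3) ^ (3 * (x:ℝ)) * (1 - w 3 * Z w) ^ (3 * (s:ℝ) - 1) * H w ^ (3 * (s:ℝ) - 1) *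
      K w * (M0 w / (1 - w 2 * (1 - w 0 - w 1)) + M1 w / (1 - w 2 * w 0) + M2 w / (1 - w 2 * w 1)))) →
    ∀ w ∈ {w : Fin 4 → ℝ | 0 < w 0 ∧ 0 < w 1 ∧ w 0 + w 1 < 1 ∧ 0 < w 2 ∧ w 2 * (1 - w 0 - w 1) < 1 ∧ w 2 * w 0 < 1 ∧ w 2 * w 1 < 1 ∧ 0 < w 3 ∧ w 3 < 1}, ∀ (d0 d1 d2 d3 : ℝ),
      HasDerivAt (fun a => c0 (Function.update w 0 a)) d0 (w 0) →
      HasDerivAt (fun a => c1 (Function.update w 1 a)) d1 (w 1) →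
      HasDerivAt (fun a => c2 (Function.update w 2 a)) d2 (w 2) →
      HasDerivAt (fun a => c3 (Function.update w 3 a)) d3 (w 3) →
      d0 - d1 + d2 - d3 = 0 := by
  intro x s _ _ Z S H K M0 M1 M2 P hZ hS hH hK hM0 hM1 hM2 hP c0 c1 c2 c3 hc0 hc1 hc2 hc3 w hw
    d0 d1 d2 d3 hd0 hd1 hd2 hd3
  obtain ⟨h0, h1, h01, hy, ha, hb, hc, hv0, hv1⟩ := hw
  -- positivity on `W`
  have ht0 : 0 < 1 - w 2 * (1 - w 0 - w 1) := by linarith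
  have ht1 : 0 < 1 - w 2 * w 0 := by linarith
  have ht2 : 0 < 1 - w 2 * w 1 := by linarith
  have hT0 : 0 < (1 - w 2 * (1 - w 0 - w 1)) * (1 - w 2 * w 0) * (1 - w 2 * w 1) := by positivity
  have hT1 : (1 - w 2 * (1 - w 0 - w 1)) * (1 - w 2 * w 0) * (1 - w 2 * w 1) < 1 := by
    have ha' : 0 < w 2 * (1 - w 0 - w 1) := mul_pos hy (by linarith)
    have hb' : 0 < w 2 * w 0 := mul_pos hy h0
    have hc' : 0 < w 2 * w 1 := mul_pos hy h1
    calc _ < 1 * 1 * (1:ℝ) := by gcongr <;> linarith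
      _ = 1 := by ring
  have hZ1 : Z w < 1 := by rw [hZ]; exact Real.rpow_lt_one hT0.le hT1 (by norm_num)
  have hZ1e := hZ1; rw [hZ w] at hZ1e
  have hvZ : 0 < 1 - w 3 * Z w := by
    have := mul_lt_one_of_nonneg_of_lt_one_left hv0.le hv1 hZ1.le; linarith
  have hvZe := hvZ; rw [hZ w] at hvZe
  have hθ0 : 0 < 1 - w 0 - w 1 := by linarith
  have hu : 0 < (1 - w 0 - w 1) * w 0 * w 1 := by positivity
  have hKe : 0 < ((1 - w 0 - w 1) * w 0 * w 1) ^ ((s:ℝ) - 1) := Real.rpow_pos_of_pos hu _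
  have hHw : H w = w 2 / (1 - Z w) := by rw [hH, hS, hZ]; exact CornerClosed.H_simpl _ _ _ hT0 hT1
  have hHp : 0 < w 2 / (1 - Z w) := div_pos hy (by linarith)
  have hHpe := hHp; rw [hZ w] at hHpe
  have hSig := CornerClosed.sigma_rel ht0 ht1 ht2 (x:ℝ)
  rw [← hZ w, ← hM0 w, ← hM1 w, ← hM2 w] at hSig
  -- direction θ₁ (coordinate 0)
  have t0d : HasDerivAt (fun a => 1 - w 2 * (1 - a - w 1)) (w 2) (w 0) :=
    (((((hasDerivAt_id' (w 0)).const_sub 1).sub_const (w 1)).const_mul (w 2)).const_sub 1).congr_deriv (by ring)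
  have t1d : HasDerivAt (fun a => 1 - w 2 * a) (-w 2) (w 0) :=
    (((hasDerivAt_id' (w 0)).const_mul (w 2)).const_sub 1).congr_deriv (by ring)
  have t2c : HasDerivAt (fun _ : ℝ => 1 - w 2 * w 1) 0 (w 0) := hasDerivAt_const _ _
  have Zd := CornerClosed.hasDerivAt_Z3 t0d t1d t2c ht0 ht1 ht2 ((1:ℝ)/3)
  have M0d := CornerClosed.hasDerivAt_M3 t0d t1d t2c ht0 ht1 ht2 (x:ℝ) ((x:ℝ) - 2/3) ((x:ℝ) - 1/3)
  have M1d := CornerClosed.hasDerivAt_M3 t0d t1d t2c ht0 ht1 ht2 ((x:ℝ) - 1/3) (x:ℝ) ((x:ℝ) - 2/3)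
  have M2d := CornerClosed.hasDerivAt_M3 t0d t1d t2c ht0 ht1 ht2 ((x:ℝ) - 2/3) ((x:ℝ) - 1/3) (x:ℝ)
  have Hd := CornerClosed.hasDerivAt_Hθ (w 2) Zd hZ1e
  have ud := ((((hasDerivAt_id' (w 0)).const_sub 1).sub_const (w 1)).fun_mul
    (hasDerivAt_id' (w 0))).mul_const (w 1)
  have Kd := CornerClosed.hasDerivAt_rpow_log ud hu ((s:ℝ) - 1)
  have Pd := CornerClosed.hasDerivAt_P (w 3 ^ (3 * (x:ℝ) - 1)) (w 3) (s:ℝ) Zd Hd Kd hvZe hHpe hKe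
  have Bd := (((((hasDerivAt_id' (w 0)).const_sub 1).sub_const (w 1)).fun_mul M0d).fun_sub
    (((hasDerivAt_id' (w 0)).const_sub 1).fun_mul M1d)).fun_add (M2d.const_mul (w 1))
  have cd := (((Pd.fun_mul (hasDerivAt_id' (w 0))).fun_mul Bd).div_const (w 2)).fun_neg
  have ev : ∀ᶠ a in 𝓝 (w 0),
      (1 - w 2 * (1 - a - w 1)) * (1 - w 2 * a) * (1 - w 2 * w 1) ∈ Set.Ioo 0 1 :=
    ContinuousAt.eventually_mem (by fun_prop) (Ioo_mem_nhds hT0 hT1)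
  have hcd : HasDerivAt (fun a => c0 (Function.update w 0 a)) _ (w 0) :=
    cd.congr_of_eventuallyEq (by
      filter_upwards [ev] with a ha
      simp only [hc0, hP, hZ, hH, hS, hK, hM0, hM1, hM2, Function.update_self, ne_eq, Fin.reduceEq,
        not_false_eq_true, Function.update_of_ne]
      rw [CornerClosed.H_simpl a (w 1) (w 2) ha.1 ha.2])
  have e0 := hd0.unique hcd
  clear t0d t1d t2c Zd M0d M1d M2d Hd ud Kd Pd Bd cd ev hcd
  -- direction θ₂ (coordinate 1)
  have t0d : HasDerivAt (fun a => 1 - w 2 * (1 - w 0 - a)) (w 2) (w 1) :=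
    ((((hasDerivAt_id' (w 1)).const_sub (1 - w 0)).const_mul (w 2)).const_sub 1).congr_deriv (by ring)
  have t1c : HasDerivAt (fun _ : ℝ => 1 - w 2 * w 0) 0 (w 1) := hasDerivAt_const _ _
  have t2d : HasDerivAt (fun a => 1 - w 2 * a) (-w 2) (w 1) :=
    (((hasDerivAt_id' (w 1)).const_mul (w 2)).const_sub 1).congr_deriv (by ring)
  have Zd := CornerClosed.hasDerivAt_Z3 t0d t1c t2d ht0 ht1 ht2 ((1:ℝ)/3)
  have M0d := CornerClosed.hasDerivAt_M3 t0d t1c t2d ht0 ht1 ht2 (x:ℝ) ((x:ℝ) - 2/3) ((x:ℝ) - 1/3)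
  have M1d := CornerClosed.hasDerivAt_M3 t0d t1c t2d ht0 ht1 ht2 ((x:ℝ) - 1/3) (x:ℝ) ((x:ℝ) - 2/3)
  have M2d := CornerClosed.hasDerivAt_M3 t0d t1c t2d ht0 ht1 ht2 ((x:ℝ) - 2/3) ((x:ℝ) - 1/3) (x:ℝ)
  have Hd := CornerClosed.hasDerivAt_Hθ (w 2) Zd hZ1e
  have ud := (((hasDerivAt_id' (w 1)).const_sub (1 - w 0)).mul_const (w 0)).fun_mul
    (hasDerivAt_id' (w 1))
  have Kd := CornerClosed.hasDerivAt_rpow_log ud hu ((s:ℝ) - 1)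
  have Pd := CornerClosed.hasDerivAt_P (w 3 ^ (3 * (x:ℝ) - 1)) (w 3) (s:ℝ) Zd Hd Kd hvZe hHpe hKe
  have Bd := ((((hasDerivAt_id' (w 1)).const_sub (1 - w 0)).fun_mul M0d).fun_neg.fun_sub
    (M1d.const_mul (w 0))).fun_add (((hasDerivAt_id' (w 1)).const_sub 1).fun_mul M2d)
  have cd := (((Pd.fun_mul (hasDerivAt_id' (w 1))).fun_mul Bd).div_const (w 2)).fun_neg
  have ev : ∀ᶠ a in 𝓝 (w 1),
      (1 - w 2 * (1 - w 0 - a)) * (1 - w 2 * w 0) * (1 - w 2 * a) ∈ Set.Ioo 0 1 :=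
    ContinuousAt.eventually_mem (by fun_prop) (Ioo_mem_nhds hT0 hT1)
  have hcd : HasDerivAt (fun a => c1 (Function.update w 1 a)) _ (w 1) :=
    cd.congr_of_eventuallyEq (by
      filter_upwards [ev] with a ha
      simp only [hc1, hP, hZ, hH, hS, hK, hM0, hM1, hM2, Function.update_self, ne_eq, Fin.reduceEq,
        not_false_eq_true, Function.update_of_ne]
      rw [CornerClosed.H_simpl (w 0) a (w 2) ha.1 ha.2])
  have e1 := hd1.unique hcd
  clear t0d t1c t2d Zd M0d M1d M2d Hd ud Kd Pd Bd cd ev hcd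
  -- direction y (coordinate 2)
  have t0d : HasDerivAt (fun a => 1 - a * (1 - w 0 - w 1)) (-(1 - w 0 - w 1)) (w 2) :=
    (((hasDerivAt_id' (w 2)).mul_const (1 - w 0 - w 1)).const_sub 1).congr_deriv (by ring)
  have t1d : HasDerivAt (fun a => 1 - a * w 0) (-w 0) (w 2) :=
    (((hasDerivAt_id' (w 2)).mul_const (w 0)).const_sub 1).congr_deriv (by ring)
  have t2d : HasDerivAt (fun a => 1 - a * w 1) (-w 1) (w 2) :=
    (((hasDerivAt_id' (w 2)).mul_const (w 1)).const_sub 1).congr_deriv (by ring)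
  have Zd := CornerClosed.hasDerivAt_Z3 t0d t1d t2d ht0 ht1 ht2 ((1:ℝ)/3)
  have M0d := CornerClosed.hasDerivAt_M3 t0d t1d t2d ht0 ht1 ht2 (x:ℝ) ((x:ℝ) - 2/3) ((x:ℝ) - 1/3)
  have M1d := CornerClosed.hasDerivAt_M3 t0d t1d t2d ht0 ht1 ht2 ((x:ℝ) - 1/3) (x:ℝ) ((x:ℝ) - 2/3)
  have M2d := CornerClosed.hasDerivAt_M3 t0d t1d t2d ht0 ht1 ht2 ((x:ℝ) - 2/3) ((x:ℝ) - 1/3) (x:ℝ)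
  have Hd := CornerClosed.hasDerivAt_Hy Zd hZ1e hy.ne'
  have Kc : HasDerivAt (fun _ : ℝ => ((1 - w 0 - w 1) * w 0 * w 1) ^ ((s:ℝ) - 1))
      (((1 - w 0 - w 1) * w 0 * w 1) ^ ((s:ℝ) - 1) * 0) (w 2) :=
    (hasDerivAt_const _ _).congr_deriv (mul_zero _).symm
  have Pd := CornerClosed.hasDerivAt_P (w 3 ^ (3 * (x:ℝ) - 1)) (w 3) (s:ℝ) Zd Hd Kc hvZe hHpe hKe
  have Bd := ((M0d.const_mul (1 - w 0 - w 1)).fun_add (M1d.const_mul (w 0))).fun_add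
    (M2d.const_mul (w 1))
  have cd := Pd.fun_mul Bd
  have ev : ∀ᶠ a in 𝓝 (w 2),
      (1 - a * (1 - w 0 - w 1)) * (1 - a * w 0) * (1 - a * w 1) ∈ Set.Ioo 0 1 :=
    ContinuousAt.eventually_mem (by fun_prop) (Ioo_mem_nhds hT0 hT1)
  have hcd : HasDerivAt (fun a => c2 (Function.update w 2 a)) _ (w 2) :=
    cd.congr_of_eventuallyEq (by
      filter_upwards [ev] with a ha
      simp only [hc2, hP, hZ, hH, hS, hK, hM0, hM1, hM2, Function.update_self, ne_eq, Fin.reduceEq,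
        not_false_eq_true, Function.update_of_ne]
      rw [CornerClosed.H_simpl (w 0) (w 1) a ha.1 ha.2])
  have e2 := hd2.unique hcd
  clear t0d t1d t2d Zd M0d M1d M2d Hd Kc Pd Bd cd ev hcd
  -- direction v (coordinate 3)
  have hcd : HasDerivAt (fun a => c3 (Function.update w 3 a))
      (w 3 ^ (3 * (x:ℝ) - 1) * (1 - w 3 * Z w) ^ (3 * (s:ℝ) - 1) * (w 2 / (1 - Z w)) ^ (3 * (s:ℝ)) *
        K w * -(1 / 3 * ((M0 w / (1 - w 2 * (1 - w 0 - w 1)) + M1 w / (1 - w 2 * w 0) +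
          M2 w / (1 - w 2 * w 1) - (M0 w + M1 w + M2 w)) / w 2) *
          (3 * (x:ℝ) - (3 * (s:ℝ) - 1) * w 3 * Z w / (1 - w 3 * Z w)))) (w 3) := by
    have h1 : HasDerivAt (fun a => a ^ (3 * (x:ℝ))) (3 * (x:ℝ) * w 3 ^ (3 * (x:ℝ) - 1)) (w 3) :=
      Real.hasDerivAt_rpow_const (Or.inl hv0.ne')
    have h2 := (((hasDerivAt_id' (w 3)).mul_const (Z w)).const_sub 1).rpow_const
      (p := 3 * (s:ℝ) - 1) (Or.inl hvZ.ne')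
    have h := (((((h1.const_mul (1 / 3 : ℝ)).fun_mul h2).mul_const (H w ^ (3 * (s:ℝ) - 1))).mul_const
      (K w)).mul_const (M0 w / (1 - w 2 * (1 - w 0 - w 1)) + M1 w / (1 - w 2 * w 0) +
        M2 w / (1 - w 2 * w 1))).fun_neg
    refine (h.congr_of_eventuallyEq (Filter.Eventually.of_forall fun a => ?_)).congr_deriv ?_
    · simp only [hc3, hZ, hH, hS, hK, hM0, hM1, hM2, Function.update_self, ne_eq, Fin.reduceEq,
        not_false_eq_true, Function.update_of_ne]
    · rw [hHw, Real.rpow_sub_one hHp.ne' (3 * (s:ℝ)), Real.rpow_sub_one hvZ.ne' (3 * (s:ℝ) - 1),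
        Real.rpow_sub_one hv0.ne' (3 * (x:ℝ)), ← hSig]
      field_simp
      ring
  have e3 := hd3.unique hcd
  subst e0 e1 e2 e3
  rw [← hZ w, ← hM0 w, ← hM1 w, ← hM2 w, ← hK w]
  have hA := CornerClosed.lemA (w 0) (w 1) (w 2) _ _ _ (M0 w) (M1 w) (M2 w) rfl rfl rfl hy.ne' ht0.ne'
    ht1.ne' ht2.ne'
  have hB := CornerClosed.lemB (w 0) (w 1) (M0 w) (M1 w) (M2 w) hθ0.ne' h0.ne' h1.ne'
  have hC := CornerClosed.lemC (w 0) (w 1) (w 2) (x:ℝ) _ _ _ (M0 w) (M1 w) (M2 w) rfl rfl rfl hy.ne'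
    ht0.ne' ht1.ne' ht2.ne'
  have hk := CornerClosed.key (v := w 3) (s := (s:ℝ)) (Z := Z w) hA hB hC
  have hZne : 1 - Z w ≠ 0 := by linarith
  have hz : M0 w + M1 w + M2 w - Z w * (M0 w / (1 - w 2 * (1 - w 0 - w 1)) + M1 w / (1 - w 2 * w 0) +
      M2 w / (1 - w 2 * w 1) - (M0 w + M1 w + M2 w)) / (1 - Z w) = 0 := by
    rw [← hSig]; field_simp; ring
  linear_combination (w 3 ^ (3 * (x:ℝ) - 1) * (1 - w 3 * Z w) ^ (3 * (s:ℝ) - 1) *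
      (w 2 / (1 - Z w)) ^ (3 * (s:ℝ)) * K w) * hk + (w 3 ^ (3 * (x:ℝ) - 1) *
      (1 - w 3 * Z w) ^ (3 * (s:ℝ) - 1) * (w 2 / (1 - Z w)) ^ (3 * (s:ℝ)) * K w * (s:ℝ) / w 2) * hz

end Summit.KontsevichZagierPeriods.TerasomaMultiplication.MultiplicationAccessible

end
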